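import Summits.AtomisticToContinuum.Crystallization.Theorems.FrustratedLawDichotomyStrainedPatchTaylorTail

/-!
# The SHARP cap lemma (2D packing orthogonal to the member ray) and (P3b) ⟸ a rim mass `≤ 38/3` (lens-5 g53, crux 27623 T-side, node T2-bent₁)

`…TaylorTail` reduced the geometric tail (P3b) `BeyondBallTail` to the weighted rim-cap count and, with the CRUDE cap lemma `#outer(a) ≤ 92`
(volume packing in a ball of radius `123/100`), to an instance rim mass `≤ 26/9`.  The cap region of a rim member `a` — cluster sites `k` with
`|z_k − z_c| > 63/10`, `|z_k − z_a| < 9/2`, where `9/5 < d = |z_a − z_c| ≤ 37/20` — is a THIN LENS: writing `X = z_k − z_c`, `Y = z_a − z_c`, the axial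
coordinate satisfies `(19.44 + d²)/2 < ⟪X, Y⟫ < (9/2)d + d²` (`inner_window`; a window of width `< 0.3163` in `⟪·, Y⟫`), so (§1–2, projection
`proj Y x = x − (⟪x, Y⟫/‖Y‖²)•Y`, Pythagoras `‖proj Y x‖²‖Y‖² = ‖x‖²‖Y‖² − ⟪x, Y⟫²`): ★ `norm_proj_sq_lt : ‖proj Y X‖² < 1.513` (exact maximum
`39.69 − (19.44 + d²)²/(4d²) ≤ 1.5095`) and ★ `norm_proj_sub_ge`: two `7/10`-separated cap sites project `≥ 0.677` apart (`0.49 − 0.3163²/3.24 ≥ 0.677²`).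
§3 ★★ `card_outer_le_sharp : Sep z → dist (z a) (z c) ≤ 37/20 → #outer(a) ≤ 21`: the projections are `0.677`-separated points within `1.2301` of `0` in the
`2`-dimensional complement `(ℝ ∙ Y)ᗮ` (`finrank = 3 − 1`), so the Literature packing bound `card_le_of_separated_of_dist_le` gives `≤ (2·1.2301/0.677 + 1)² < 22`.
§4 consequently (weights `≤ 1/400`, `21/400 · B ≤ 2/3` iff `B ≤ 800/63`): `rimCapCount_of_rimMassLe : 21/400·B ≤ 2/3 → RimMassLe B → RimCapCount`,
`rimMassLe_of_instance : InstanceRimMassLe B → RimMassLe B`, and the headline ★★★ `taylorTwoBent1_of_instanceRimMass12 : InstanceRimMassLe (38/3) → TaylorTwoBent1`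
— the instance-only residual is now `Σ_{b ∈ instRim(z₁, c₁)} 1/#B_{z₁}(b) ≤ 38/3` (ideal fcc/hcp: `≤ 0.56`; crude lattice counting `#instRim ≤ 66`, `#B ≥ 13` already gives `≤ 5.1`).
NODE OF RECORD: (T2-bent₁) ⟸ (P3b-inst′) `InstanceRimMassLe (38/3)`.
-/

open scoped BigOperators Classical
open Summit.AtomisticToContinuum.Crystallization.Theorems.FrustratedLawDichotomyRangeCut (Sep)
open Summit.AtomisticToContinuum.Crystallization.Theorems.FrustratedLawDichotomyMotifLemmas
open Summit.AtomisticToContinuum.Crystallization.Theorems.FrustratedLawDichotomyAveragingCut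
open Summit.AtomisticToContinuum.Crystallization.Theorems.FrustratedLawDichotomyAveragingRuleCap
open Summit.AtomisticToContinuum.Crystallization.Theorems.FrustratedLawDichotomyAveragingRuleTightFree
open Summit.AtomisticToContinuum.Crystallization.Theorems.FrustratedLawDichotomyExemptAbsorptionRecord
open Summit.AtomisticToContinuum.Crystallization.Theorems.FrustratedLawDichotomySchurCut
open Literature.MathematicalPhysics.StatisticalMechanics (lennardJones lennardJones_nonpos)
open Summit.AtomisticToContinuum.Crystallization.Theorems.FrustratedLawDichotomyRuleToolkitGood
open Summit.AtomisticToContinuum.Crystallization.Theorems.FrustratedLawDichotomyStrainedPatchHomSplit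
open Summit.AtomisticToContinuum.Crystallization.Theorems.FrustratedLawDichotomyStrainedPatchHomTermCalculus
open Summit.AtomisticToContinuum.Crystallization.Theorems.FrustratedLawDichotomyStrainedPatchChartFamilies
open Summit.AtomisticToContinuum.Crystallization.Theorems.FrustratedLawDichotomyStrainedPatchChartFamiliesBent
open Summit.AtomisticToContinuum.Crystallization.Theorems.FrustratedLawDichotomyStrainedPatchChartFamiliesPinned
open Summit.AtomisticToContinuum.Crystallization.Theorems.FrustratedLawDichotomyStrainedPatchEnvelopeLaw
open Summit.AtomisticToContinuum.Crystallization.Theorems.FrustratedLawDichotomyStrainedPatchEnvelopeTaylor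

open Summit.AtomisticToContinuum.Crystallization.Theorems.FrustratedLawDichotomyStrainedPatchTaylorSplit
open Summit.AtomisticToContinuum.Crystallization.Theorems.FrustratedLawDichotomyStrainedPatchTaylorPair
open Summit.AtomisticToContinuum.Crystallization.Theorems.FrustratedLawDichotomyStrainedPatchTaylorChord

open Summit.AtomisticToContinuum.Crystallization.Theorems.FrustratedLawDichotomyStrainedPatchTaylorLeaves

open Summit.AtomisticToContinuum.Crystallization.Theorems.FrustratedLawDichotomyStrainedPatchTaylorRegular
open Summit.AtomisticToContinuum.Crystallization.Theorems.FrustratedLawDichotomyStrainedPatchTaylorKbandKit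
open Summit.AtomisticToContinuum.Crystallization.Theorems.FrustratedLawDichotomyStrainedPatchTaylorKband
open Summit.AtomisticToContinuum.Crystallization.Theorems.FrustratedLawDichotomyStrainedPatchTaylorTail

namespace Summit.AtomisticToContinuum.Crystallization.Theorems.FrustratedLawDichotomyStrainedPatchTaylorCap


/-! ## §1. Projection orthogonal to the member ray -/

/-- The projection of `x` orthogonal to `Y`: `x − (⟪x, Y⟫/‖Y‖²)•Y`. -/
noncomputable def proj (Y x : E3) : E3 := x - (inner ℝ x Y / ‖Y‖ ^ 2) • Y

/-- `proj Y x ⟂ Y`. [formal bookkeeping] -/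
theorem inner_proj_eq_zero {Y : E3} (hY : Y ≠ 0) (x : E3) : inner ℝ Y (proj Y x) = 0 := by
  have hn : ‖Y‖ ^ 2 ≠ 0 := pow_ne_zero 2 (norm_ne_zero_iff.2 hY)
  rw [proj, inner_sub_right, real_inner_smul_right, real_inner_self_eq_norm_sq, real_inner_comm]
  field_simp
  ring

/-- `proj` is additive: `proj Y x − proj Y x' = proj Y (x − x')`. [formal bookkeeping] -/
theorem proj_sub (Y x x' : E3) : proj Y x - proj Y x' = proj Y (x - x') := by
  simp only [proj, inner_sub_left, sub_div, sub_smul]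
  abel

/-- Pythagoras for the projection: `‖proj Y x‖²·‖Y‖² = ‖x‖²·‖Y‖² − ⟪x, Y⟫²`. [formal bookkeeping] -/
theorem norm_proj_sq {Y : E3} (hY : Y ≠ 0) (x : E3) : ‖proj Y x‖ ^ 2 * ‖Y‖ ^ 2 = ‖x‖ ^ 2 * ‖Y‖ ^ 2 - (inner ℝ x Y) ^ 2 := by
  have hn : ‖Y‖ ^ 2 ≠ 0 := pow_ne_zero 2 (norm_ne_zero_iff.2 hY)
  rw [proj, norm_sub_sq_real, real_inner_smul_right, norm_smul, Real.norm_eq_abs, mul_pow, sq_abs]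
  field_simp
  ring

/-! ## §2. The thin lens: projected radius `< 1.2301`, projected separation `≥ 0.677` -/

/-- The axial window of an outer partner: `(19.44 + d²)/2 < ⟪X, Y⟫ < (9/2)d + d²` (`X = z_k − z_c`, `Y = z_a − z_c`, `d = ‖Y‖`). [folklore] -/
theorem inner_window {X Y : E3} (hA : 63 / 10 < ‖X‖) (hB : ‖X - Y‖ < 9 / 2) (hd : 0 < ‖Y‖) :
    (1944 / 100 + ‖Y‖ ^ 2) / 2 < inner ℝ X Y ∧ inner ℝ X Y < 9 / 2 * ‖Y‖ + ‖Y‖ ^ 2 := by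
  have e1 : ‖X - Y‖ ^ 2 = ‖X‖ ^ 2 - 2 * inner ℝ X Y + ‖Y‖ ^ 2 := norm_sub_sq_real _ _
  have hA2 : (63 / 10 : ℝ) ^ 2 < ‖X‖ ^ 2 := by nlinarith [norm_nonneg X]
  have hB2 : ‖X - Y‖ ^ 2 < (9 / 2 : ℝ) ^ 2 := by nlinarith [norm_nonneg (X - Y)]
  refine ⟨by linarith, ?_⟩
  have hX : ‖X‖ < 9 / 2 + ‖Y‖ := by
    have h2 : ‖X‖ ≤ ‖Y‖ + ‖X - Y‖ := norm_le_insert' X Y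
    linarith
  have hcs : inner ℝ X Y ≤ ‖X‖ * ‖Y‖ := real_inner_le_norm _ _
  nlinarith

/-- ★ Projected radius: an outer partner of a rim member projects within `√1.513 < 1.2301` of the axis: `‖proj Y X‖² < 1513/1000`
(exact maximum `39.69 − (19.44 + d²)²/(4d²) ≤ 1.5095` at `‖X‖ = 63/10`, `d = 37/20`). [folklore] -/
theorem norm_proj_sq_lt {X Y : E3} (hA : 63 / 10 < ‖X‖) (hB : ‖X - Y‖ < 9 / 2) (hd1 : 9 / 5 < ‖Y‖) (hd2 : ‖Y‖ ≤ 37 / 20) :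
    ‖proj Y X‖ ^ 2 < 1513 / 1000 := by
  have hd : 0 < ‖Y‖ := by linarith
  have hY : Y ≠ 0 := norm_ne_zero_iff.1 hd.ne'
  have hP := norm_proj_sq hY X
  obtain ⟨hs1, hs2⟩ := inner_window hA hB hd
  have hA2 : (63 / 10 : ℝ) ^ 2 < ‖X‖ ^ 2 := by nlinarith [norm_nonneg X]
  have hD1 : (9 / 5 : ℝ) ^ 2 < ‖Y‖ ^ 2 := by nlinarith
  have hD2 : ‖Y‖ ^ 2 ≤ (37 / 20 : ℝ) ^ 2 := by nlinarith
  have e1 : ‖X - Y‖ ^ 2 = ‖X‖ ^ 2 - 2 * inner ℝ X Y + ‖Y‖ ^ 2 := norm_sub_sq_real _ _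
  have hB2 : ‖X - Y‖ ^ 2 < (9 / 2 : ℝ) ^ 2 := by nlinarith [norm_nonneg (X - Y)]
  set A := ‖X‖ ^ 2 with hAdef
  set D := ‖Y‖ ^ 2 with hDdef
  set s := inner ℝ X Y with hsdef
  have hm : 0 < 2 * s - (A + D - 2025 / 100) := by linarith
  have hm' : 0 < 2 * s + (A + D - 2025 / 100) := by linarith
  have hss : (A + D - 2025 / 100) ^ 2 < 4 * s ^ 2 := by nlinarith [mul_pos hm hm']
  -- `‖proj‖²·D = A·D − s² < A·D − (A + D − 20.25)²/4 ≤ 1.513·D`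
  have key : A * D - (A + D - 2025 / 100) ^ 2 / 4 < 1513 / 1000 * D := by
    nlinarith [mul_nonneg (sub_nonneg.2 hA2.le) (sub_nonneg.2 hD2), sq_nonneg (A - D - 3969 / 100 + 1369 / 400)]
  have h1 : ‖proj Y X‖ ^ 2 * D < 1513 / 1000 * D := by rw [hP]; linarith
  exact lt_of_mul_lt_mul_right h1 (by linarith)

/-- ★ Projected separation: two outer partners of the same rim member (`7/10`-separated) project at distance `≥ 677/1000`
(axial coordinates differ by `< 0.3163/d`, so `‖proj(X − X')‖² ≥ 0.49 − 0.3163²/3.24`). [folklore] -/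
theorem norm_proj_sub_ge {X X' Y : E3} (hA : 63 / 10 < ‖X‖) (hB : ‖X - Y‖ < 9 / 2) (hA' : 63 / 10 < ‖X'‖) (hB' : ‖X' - Y‖ < 9 / 2)
    (hd1 : 9 / 5 < ‖Y‖) (hd2 : ‖Y‖ ≤ 37 / 20) (hsep : 7 / 10 ≤ ‖X - X'‖) : 677 / 1000 ≤ ‖proj Y X - proj Y X'‖ := by
  have hd : 0 < ‖Y‖ := by linarith
  have hY : Y ≠ 0 := norm_ne_zero_iff.1 hd.ne'
  rw [proj_sub]
  have hP := norm_proj_sq hY (X - X')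
  obtain ⟨hs1, hs2⟩ := inner_window hA hB hd
  obtain ⟨hs1', hs2'⟩ := inner_window hA' hB' hd
  have hD1 : (9 / 5 : ℝ) ^ 2 < ‖Y‖ ^ 2 := by nlinarith
  have hD2 : ‖Y‖ ^ 2 ≤ (37 / 20 : ℝ) ^ 2 := by nlinarith
  have hsep2 : (7 / 10 : ℝ) ^ 2 ≤ ‖X - X'‖ ^ 2 := by nlinarith
  have hdiff : inner ℝ (X - X') Y = inner ℝ X Y - inner ℝ X' Y := inner_sub_left _ _ _
  have hw1 : inner ℝ X Y - inner ℝ X' Y < 3163 / 10000 := by nlinarith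
  have hw2 : inner ℝ X' Y - inner ℝ X Y < 3163 / 10000 := by nlinarith
  have hsq : (inner ℝ (X - X') Y) ^ 2 ≤ (3163 / 10000 : ℝ) ^ 2 := by
    rw [hdiff]; nlinarith
  -- `‖proj (X − X')‖²·D = ‖X − X'‖²·D − ⟪X − X', Y⟫² ≥ 0.49·D − 0.3163² ≥ 0.677²·D` (as `D ≥ 3.24`)
  have h1 : (677 / 1000 : ℝ) ^ 2 * ‖Y‖ ^ 2 ≤ ‖proj Y (X - X')‖ ^ 2 * ‖Y‖ ^ 2 := by rw [hP]; nlinarith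
  have h2 : (677 / 1000 : ℝ) ^ 2 ≤ ‖proj Y (X - X')‖ ^ 2 := le_of_mul_le_mul_right h1 (by positivity)
  nlinarith [norm_nonneg (proj Y (X - X')), h2]

/-! ## §3. The sharp cap lemma: 2D packing in the plane orthogonal to the member ray -/

/-- ★★ SHARP CAP LEMMA: a site `a` with `dist (z a) (z c) ≤ 37/20` has at most `21` outer partners (`(2·1.2301/0.677 + 1)² < 21.5`):
their projections orthogonal to `z a − z c` are `0.677`-separated points of a disc of radius `1.2301` in the `2`-dimensional complement. [folklore] -/
theorem card_outer_le_sharp {M : ℕ} {z : Fin M → E3} {c a : Fin M} (hsep : Sep z) (hd2 : dist (z a) (z c) ≤ 37 / 20) :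
    ((outer z c a).card : ℝ) ≤ 21 := by
  by_cases hne : (outer z c a).Nonempty
  swap
  · rw [Finset.not_nonempty_iff_eq_empty.1 hne, Finset.card_empty]; norm_num
  obtain ⟨k₀, hk₀⟩ := hne
  have hd1 : 9 / 5 < dist (z a) (z c) := by
    obtain ⟨h1, h2⟩ := (Finset.mem_filter.1 hk₀).2
    have htri : dist (z k₀) (z c) ≤ dist (z a) (z k₀) + dist (z a) (z c) := by
      rw [dist_comm (z a) (z k₀)]; exact dist_triangle _ _ _
    linarith
  set Y : E3 := z a - z c with hYdef
  have hYn1 : 9 / 5 < ‖Y‖ := by rwa [hYdef, ← dist_eq_norm]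
  have hYn2 : ‖Y‖ ≤ 37 / 20 := by rwa [hYdef, ← dist_eq_norm]
  have hY : Y ≠ 0 := norm_ne_zero_iff.1 (by linarith)
  have hout : ∀ k ∈ outer z c a, 63 / 10 < ‖z k - z c‖ ∧ ‖(z k - z c) - Y‖ < 9 / 2 := by
    intro k hk
    obtain ⟨h1, h2⟩ := (Finset.mem_filter.1 hk).2
    refine ⟨by rwa [← dist_eq_norm], ?_⟩
    rw [hYdef, show (z k - z c) - (z a - z c) = z k - z a by abel, ← dist_eq_norm, dist_comm]; exact h2
  let K : Submodule ℝ E3 := (ℝ ∙ Y)ᗮ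
  have hmem : ∀ x, proj Y x ∈ K := fun x => Submodule.mem_orthogonal_singleton_iff_inner_right.2 (inner_proj_eq_zero hY x)
  let f : Fin M → K := fun k => ⟨proj Y (z k - z c), hmem _⟩
  have hfd : ∀ k k', dist (f k) (f k') = ‖proj Y (z k - z c) - proj Y (z k' - z c)‖ := by
    intro k k'; rw [Subtype.dist_eq, dist_eq_norm]
  have hsep' : ∀ k ∈ outer z c a, ∀ k' ∈ outer z c a, k ≠ k' → 677 / 1000 ≤ dist (f k) (f k') := by
    intro k hk k' hk' hkk
    rw [hfd]
    obtain ⟨hA, hB⟩ := hout k hk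
    obtain ⟨hA', hB'⟩ := hout k' hk'
    have hs : 7 / 10 ≤ ‖(z k - z c) - (z k' - z c)‖ := by
      rw [show (z k - z c) - (z k' - z c) = z k - z k' by abel, ← dist_eq_norm]; exact hsep k k' hkk
    exact norm_proj_sub_ge hA hB hA' hB' hYn1 hYn2 hs
  have hinj : Set.InjOn f ↑(outer z c a) := by
    intro k hk k' hk' hkk'
    by_contra hkk
    have h := hsep' k (Finset.mem_coe.1 hk) k' (Finset.mem_coe.1 hk') hkk
    rw [hkk', dist_self] at h
    norm_num at h
  have hcard : ((outer z c a).image f).card = (outer z c a).card := Finset.card_image_of_injOn hinj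
  have hK : Module.finrank ℝ K = 2 := by
    have h1 := Submodule.finrank_add_finrank_orthogonal (ℝ ∙ Y)
    rw [finrank_span_singleton hY, finrank_euclideanSpace_fin] at h1
    change Module.finrank ℝ (ℝ ∙ Y)ᗮ = 2
    omega
  have h := Literature.MathematicalPhysics.StatisticalMechanics.card_le_of_separated_of_dist_le ((outer z c a).image f) (0 : K)
    (r := 677 / 1000) (R := 12301 / 10000) (by norm_num) (by norm_num) ?_ ?_
  · rw [hcard, hK] at h
    have h22r : ((outer z c a).card : ℝ) < 22 := h.trans_lt (by norm_num)
    have h22 : (outer z c a).card < 22 := by exact_mod_cast h22r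
    have h21 : (outer z c a).card ≤ 21 := Nat.lt_succ_iff.1 h22
    exact_mod_cast h21
  · intro x hx
    obtain ⟨k, hk, rfl⟩ := Finset.mem_image.1 hx
    rw [dist_zero_right]
    change ‖proj Y (z k - z c)‖ ≤ _
    obtain ⟨hA, hB⟩ := hout k hk
    have := norm_proj_sq_lt hA hB hYn1 hYn2
    nlinarith [norm_nonneg (proj Y (z k - z c))]
  · intro x hx y hy hxy
    obtain ⟨k, hk, rfl⟩ := Finset.mem_image.1 hx
    obtain ⟨k', hk', rfl⟩ := Finset.mem_image.1 hy
    exact hsep' k hk k' hk' (fun h => hxy (by rw [h]))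

/-! ## §4. (P3b) from a rim mass `≤ 38/3` via the sharp cap lemma -/

/-- **(P3b-mass′) `RimMassLe B`** — the rim members' inverse instance-memberships sum to at most `B`: `Σ_{a ∈ rim} 1/#B_{z₁}(e a) ≤ B`. -/
def RimMassLe (B : ℝ) : Prop :=
  Frame fun _ z c _ z₁ c₁ e => ∑ a ∈ rimMembers z c z₁ c₁ e, (((ball (9 / 5) z₁ (e a)).card : ℝ))⁻¹ ≤ B

/-- **(P3b-inst′) `InstanceRimMassLe B`** [INSTANCE GEOMETRY ONLY] — for every comparison instance `(z₁, c₁) ∈ 𝓘₁⁺`: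
`Σ_{b : 7/4 < |z₁ b − z₁ c₁| ≤ 9/5} 1/#B_{z₁}(b) ≤ B` (no cluster in the statement). -/
def InstanceRimMassLe (B : ℝ) : Prop :=
  ∀ (M₁ : ℕ) (z₁ : Fin M₁ → E3) (c₁ : Fin M₁), CompFamily1 M₁ z₁ c₁ →
    ∑ b ∈ instRim z₁ c₁, (((ball (9 / 5) z₁ b).card : ℝ))⁻¹ ≤ B

/-- ★★ **(P3b-mass′) ⟹ (P3b-count)** with the SHARP cap lemma: any rim-mass bound `B` with `21/400·B ≤ 2/3` suffices. [folklore] -/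
theorem rimCapCount_of_rimMassLe {B : ℝ} (hB : 21 / 400 * B ≤ 2 / 3) (h : RimMassLe B) : RimCapCount := by
  intro M z c M₁ z₁ c₁ e t hz hch hf
  have hX := h M z c M₁ z₁ c₁ e t hz hch hf
  have hle : ∀ a ∈ members z c z₁ c₁ e,
      (dist (z a) (z c) - 9 / 5) ^ 2 * ((outer z c a).card : ℝ) / ((ball (9 / 5) z₁ (e a)).card : ℝ) ≤
        if a ∈ rimMembers z c z₁ c₁ e then 21 / 400 * (((ball (9 / 5) z₁ (e a)).card : ℝ))⁻¹ else 0 := by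
    intro a ha
    by_cases hne : (outer z c a).Nonempty
    · rw [if_pos (rim_of_outer_nonempty ha hne), div_eq_mul_inv]
      refine mul_le_mul_of_nonneg_right ?_ (by positivity)
      have h1 := weight_le_of_outer_nonempty hf ha hne
      have h2 := card_outer_le_sharp hz.2.1 (dist_le_of_member hf ha)
      nlinarith [sq_nonneg (dist (z a) (z c) - 9 / 5), Nat.cast_nonneg (α := ℝ) (outer z c a).card]
    · rw [Finset.not_nonempty_iff_eq_empty.1 hne, Finset.card_empty, Nat.cast_zero, mul_zero, zero_div]
      split_ifs <;> positivity
  refine (Finset.sum_le_sum hle).trans ?_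
  rw [← Finset.sum_filter, show (members z c z₁ c₁ e).filter (fun a => a ∈ rimMembers z c z₁ c₁ e) = rimMembers z c z₁ c₁ e by
    ext a; simp only [rimMembers, Finset.mem_filter]; tauto, ← Finset.mul_sum]
  have hsum0 : 0 ≤ ∑ a ∈ rimMembers z c z₁ c₁ e, (((ball (9 / 5) z₁ (e a)).card : ℝ))⁻¹ := Finset.sum_nonneg fun _ _ => by positivity
  nlinarith

/-- ★ **(P3b-inst′) ⟹ (P3b-mass′)** (`e` injective on members, rim members map into the instance rim). [folklore] -/
theorem rimMassLe_of_instance {B : ℝ} (h : InstanceRimMassLe B) : RimMassLe B := by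
  intro M z c M₁ z₁ c₁ e t hz hch hf
  have hI := h M₁ z₁ c₁ hch.1
  have hinj : Set.InjOn e ↑(rimMembers z c z₁ c₁ e) := by
    intro a ha b hb hab
    have ha' := (Finset.mem_filter.1 (Finset.mem_filter.1 (Finset.mem_coe.1 ha)).1).1
    have hb' := (Finset.mem_filter.1 (Finset.mem_filter.1 (Finset.mem_coe.1 hb)).1).1
    exact hch.2.2.2.2.1 a b (mem_ball.1 ha') (mem_ball.1 hb') hab
  have hsub : (rimMembers z c z₁ c₁ e).image e ⊆ instRim z₁ c₁ := by
    intro b hb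
    obtain ⟨a, ha, rfl⟩ := Finset.mem_image.1 hb
    exact image_mem_instRim hf ha
  calc ∑ a ∈ rimMembers z c z₁ c₁ e, (((ball (9 / 5) z₁ (e a)).card : ℝ))⁻¹
      = ∑ b ∈ (rimMembers z c z₁ c₁ e).image e, (((ball (9 / 5) z₁ b).card : ℝ))⁻¹ :=
        (Finset.sum_image (f := fun b => (((ball (9 / 5) z₁ b).card : ℝ))⁻¹) hinj).symm
    _ ≤ ∑ b ∈ instRim z₁ c₁, (((ball (9 / 5) z₁ b).card : ℝ))⁻¹ :=
        Finset.sum_le_sum_of_subset_of_nonneg hsub fun _ _ _ => by positivity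
    _ ≤ B := hI

/-- The crude residual of `…TaylorTail` is the case `B = 26/9`. [formal bookkeeping] -/
theorem instanceRimMassLe_of_instanceRimMass (h : InstanceRimMass) : InstanceRimMassLe (26 / 9) := h

/-- ★★ **(P3b) ⟸ (P3b-inst′)** with `B = 38/3` (`21/400 · 38/3 = 0.665 ≤ 2/3`). [folklore] -/
theorem beyondBallTail_of_instanceRimMass12 (h : InstanceRimMassLe (38 / 3)) : BeyondBallTail :=
  beyondBallTail_of_rimCapCount (rimCapCount_of_rimMassLe (by norm_num) (rimMassLe_of_instance h))

/-- ★★★ (T2-bent₁) from the instance-only rim mass `≤ 38/3`: `InstanceRimMassLe (38/3) → TaylorTwoBent1`. [folklore] -/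
theorem taylorTwoBent1_of_instanceRimMass12 (h : InstanceRimMassLe (38 / 3)) : TaylorTwoBent1 :=
  taylorTwoBent1_of_tail (beyondBallTail_of_instanceRimMass12 h)

end Summit.AtomisticToContinuum.Crystallization.Theorems.FrustratedLawDichotomyStrainedPatchTaylorCap
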